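import Summits.BirchSwinnertonDyer.BirchSwinnertonDyer.Theorems.CumulativeHeegnerLeopoldtRedSplitControlAtThreeShaTwoIdele
import Summits.BirchSwinnertonDyer.BirchSwinnertonDyer.Theorems.SchneiderFreeAdditiveX3PoitouTateShaDualOfR4A
import Summits.BirchSwinnertonDyer.BirchSwinnertonDyer.Theorems.SchneiderFreeAdditiveX3PoitouTateReciprocitySumHolds
import HarnessLib

/-!
# K4 `RedSplitControlAtThree` — PT2 (`poitouTate_sha_tateDual K`, `K` totally complex) from the reciprocity identity (R4)
# ALONE; property (e) `Ш²(K, M^D) ⊆ Im Ψ` of the native obstruction map UNCONDITIONALLY (seat `bsd-line-chl-p2`, gen 7)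

HONEST FRAMING (cell `bsd-wall`): BSD is NOT proved here and no case of Poitou–Tate duality is proved outright.  Three cells'
theorems are composed:
* (A) — `tateDual_localGlobal` (this seat, file `…ShaTwoIdele`: Brauer–Hasse–Noether over `K(M)` + inf–res + Hilbert 90);
* (B) — `IdeleReadout.sha_hom_units_dies_in_idele` (door-c5 g18: the idèle-torus Hasse principle for the relation lattice);
* `hcomp` — `selmerComplement_canonical_holds` (door-c4 g18: `SelmerComplement` of THE canonical local invariant maps);
* the Tate-duality record for `C̄` with `classBarInv K`, THE idèle projections and (R3) for them (door-c4/c5/c6,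
  inside `poitouTate_sha_tateDual_of_R4_A`).
NET: `poitouTate_sha_tateDual K` for totally complex `K` follows from the single displayed hypothesis (R4) — the E-side
reciprocity identity in equality form with a bijective bridge `nat` (door-c4 lane) — and property (e) of the `Ш²`-readout
road (`Ш²(K, M^D) ⊆ Im (shaTwoConnecting ρ n hM)`) is a theorem.

## References
* J. S. Milne, *Arithmetic Duality Theorems* (2006), I Thm. 4.10 (a) and its proof (p. 58), I Lemma 4.13. [MilneADT2006]
* D. Harari, *Galois Cohomology and Class Field Theory* (2020), Thm. 17.13 (b). [Harari2020]
-/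

noncomputable section

open Function NumberField IsDedekindDomain CategoryTheory CategoryTheory.Abelian
open scoped NumberField ContRepresentation

-- `Summit.<P>.<Sub>` repeats `BirchSwinnertonDyer` by the tree's layout convention (D-0017)
set_option linter.dupNamespace false

namespace Summit.BirchSwinnertonDyer.BirchSwinnertonDyer.Theorems.PoitouTateShaTwoReadout

open Field
open Literature.NumberTheory.GaloisRepresentations Literature.NumberTheory.GaloisCohomology
open Literature.NumberTheory.GaloisRepresentations.DiscreteGaloisModule (TateDual tateDual shaTwo unramifiedSubgroup
  localTatePairingZMod)
open Literature.Algebra.Homology Literature.Algebra.Homology.DiscreteRep Literature.Algebra.Homology.ExtPresentation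
open Literature.NumberTheory.GaloisRepresentations.IdeleClassBar (classBarD classBarInv)
open Literature.AnabelianGeometry.AbsoluteAnabelian.Prop121vii (zmodToQmodZ)
open Literature.NumberTheory.GaloisRepresentations.FreePresentation (presentationComplex presentationComplex_shortExact)
open Literature.NumberTheory.GaloisRepresentations.HomDual (readout shaTwoConnecting)
open Literature.NumberTheory.GaloisRepresentations.IdeleReadout (ideleProjection exists_shaTwoConnecting_eq_of_localGlobalTwo)
open Summit.BirchSwinnertonDyer.BirchSwinnertonDyer.Theorems.SchneiderFreeAdditiveX3.PoitouTateReduction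
  (poitouTate_sha_tateDual_of_R4_A selmerComplement_canonical_holds)

variable {K : Type} [Field K] [NumberField K]

/-- **Property (e) of the `Ш²`-readout road, UNCONDITIONALLY** (`K` totally complex): every class of `Ш²(K, M^D)` is in
the image of the native obstruction map `Ψ = shaTwoConnecting ρ n hM : Hom_Γ(N₁, C̄) → H²(K, M^D)` — door-c5 g18's
`exists_shaTwoConnecting_eq_of_localGlobalTwo` ((e) ⟸ (A)) with (A) := `tateDual_localGlobal`.
[cite: MilneADT2006, I Thm. 4.10 (a) (proof, p. 58), Lemma 4.13] -/
theorem exists_shaTwoConnecting_eq_of_mem_shaTwo [IsTotallyComplex K] {M : Type} [AddCommGroup M] [TopologicalSpace M]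
    [DiscreteTopology M] [Finite M] (ρ : DiscreteGaloisModule K M) (n : ℕ) [NeZero n] (hM : ∀ m : M, n • m = 0)
    (c : galoisCohomology (ρ.tateDual n) 2) (hc : c ∈ shaTwo (ρ.tateDual n)) :
    ∃ h : (presentationComplex ρ).X₁ ⟶ classBarD K, shaTwoConnecting ρ n hM h = c :=
  exists_shaTwoConnecting_eq_of_localGlobalTwo ρ n hM (tateDual_localGlobal ρ n hM) c hc

/-- **THE NAMED FACT `poitouTate_sha_tateDual K` for a TOTALLY COMPLEX `K` from the reciprocity identity (R4) ALONE.**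
Composition of door-c4 g18's `poitouTate_sha_tateDual_of_R4_A` (PT2 ⟸ `hcomp ∧ hR4 ∧ hA`; (B), (R3), the Tate-duality
record and THE idèle projections inside) with `hcomp := selmerComplement_canonical_holds` (door-c4 g18) and
`hA := tateDual_localGlobal` (this seat).  The one displayed hypothesis (R4): for every level `n ≥ 1` and finite `n`-torsion
`M₀`, a bijective bridge `nat : H¹(K, M₀^{DD}) ≃ Ext¹_{C_Γ}(ℤ, X₃)` under which, for every `f : N₁ ⟶ J̄/…` and all large
finite `T'`, the sum over `T'` of the local Tate pairings of the readouts of `f` against the localisations of `y` equals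
`classBarInv K ((nat y) ∘ ∂(f ≫ g))`.  HONEST FRAMING: a reduction; no case of BSD; Poitou–Tate (a) is not proved outright.
[cite: MilneADT2006, Ch. I, Thm. 4.10 (a) (proof, p. 58), Lemma 4.13][cite: Harari2020, Thm. 17.13 (b)] -/
theorem poitouTate_sha_tateDual_of_R4 [IsTotallyComplex K]
    (hR4 : ∀ (n : ℕ) [NeZero n],
      ∀ ⦃M : Type⦄ [AddCommGroup M] [TopologicalSpace M] [DiscreteTopology M] [Finite M] [Finite (TateDual K M n)]
      (ρ₀ : DiscreteGaloisModule K M) (hM : ∀ m : M, n • m = 0),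
      ∃ nat : galoisCohomology ((ρ₀.tateDual n).tateDual n) 1 →+
          Abelian.Ext (triv (Γ := absoluteGaloisGroup K) ℤ) (presentationComplex ρ₀).X₃ 1,
        Function.Bijective nat ∧
        ∀ f : (presentationComplex ρ₀).X₁ ⟶ (ideleClassLimitShortComplex K).X₂, ∃ Tf : Finset (Place K),
          ∀ (y : galoisCohomology ((ρ₀.tateDual n).tateDual n) 1) (T' : Finset (Place K)), Tf ⊆ T' →
            (∀ v : HeightOneSpectrum (𝓞 K), (Sum.inr v : Place K) ∉ T' →
              galoisCohomology.localization ((ρ₀.tateDual n).tateDual n) (Sum.inr v) 1 y ∈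
                unramifiedSubgroup (GaloisRep.toLocal v ((ρ₀.tateDual n).tateDual n)) 1) →
            zmodToQmodZ n (∑ v ∈ T', localTatePairingZMod (ρ₀.tateDual n) n v (LocalInvariants.canonical K n v)
              (readout ρ₀ n hM (ideleProjection K v) f)
              (galoisCohomology.localization ((ρ₀.tateDual n).tateDual n) v 1 y)) =
            classBarInv K ((nat y).comp (boundary (presentationComplex_shortExact ρ₀) (classBarD K)
              (f ≫ (ideleClassLimitShortComplex K).g)) (rfl : 1 + 1 = 2))) :
    poitouTate_sha_tateDual K :=
  poitouTate_sha_tateDual_of_R4_A (fun n _ => selmerComplement_canonical_holds K n) hR4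
    (fun n _ _ _ _ _ _ ρ₀ hM => tateDual_localGlobal ρ₀ n hM)

end Summit.BirchSwinnertonDyer.BirchSwinnertonDyer.Theorems.PoitouTateShaTwoReadout

end
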